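import Literature.MathematicalPhysics.QuantumFieldTheory.Balaban1983to89.Beta.LogDetHessian
import Summits.QuantumFields.BalabanUV.Beta.D1BFx.MixedVarPackedHess

/-!
# `BalabanUV.Beta.PolarizationHessT` — binder row D1, route (O3), work item W-4 step 0: **THE ONE-LOOP POLARIZATION OF A `Family` IS MINUS THE TORUS
# ONE-LOOP FUNCTIONAL `hessT` OF ITS BORDERED INVERSE AGAINST ITS JETS**, `polarization F i j = −hessT (K₀⁻¹) (∂ᵢK) (∂ⱼK) (∂ᵢ∂ⱼK)`, (the first jet `∂ᵢ log Z(0) = −½·tr(K₀⁻¹·∂ᵢK)`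
# being `LogZFirstJet.fderiv_logZ_single`) — the dictionary between an2's `Family` calculus (`LogDetHessian`, `LogZFirstJet`) and road BF-x's
# leg currency (`D1BFx.MixedVarPackedHess.hessT`, the finite-index twin of `ExpKernelCalculus.hessKer`)
# (β sub-cell, BINDER-OWNERS row D1 OWNER, lineage an2 gen 24; `ROUTE-O3.md` §1 (1) ∕ §3 W-4)

HONEST FRAMING (cell charter, verbatim): «discharging BetaPertH makes Balaban's UV stability UNCONDITIONAL — a real
constructive-QFT result; it is NOT the continuum limit and NOT the Clay problem.»
HONEST DEPENDENCY: continuum YM on T⁴ ⇐ BetaPertH ∧ nine spine estimates (0/9 proved); BetaPertH ⇐ (D1) ∧ (D4) ∧ CAP+tail;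
G-an2-4 gates asym, D1 and NE2/3/4.
ABSOLUTE RULE (cell, verbatim): «No internally-minted statement may enter as a cited fact. Every hypothesis is either kernel-proved in this
package or a verbatim quotation of a PUBLISHED theorem with page reference. The manuscript(s) under audit are NOT citable for their own
disputed steps — they are the thing under adjudication; programme-internal (2001/route/tribunal) claims are never citable.»
NOTHING below is cited: no `[cite: …]`, no `def`, no `Prop` fact.  [folklore] rewriting of pv09∕an2's `LogDetHessian.Family.polarization_eq_trace` and an2's
`LogZFirstJet.fderiv_logZ_single` in the `hessT` currency of the G-an2-4∕BF-x swarm's `MixedVarPackedHess` BY NAME.  It asserts nothing about Bałaban's objects.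

WHY (row-D1 owner, gen 24).  ROUTE (O3) §1 (1) identifies the row's kernels with second jets of one-loop functionals «by inspection»: `TbalOf … = d²_B F_j`, with
`hessKer G V W = ½·tadpole − ½·bubble`.  Road BF-x works on cubic tori with `hessT L V V′ W = ½·(tr(L·W) − tr(L·V·(L·V′)))` (TA4) and sends `hessT → hessKer` as
`T ↗ ℤ⁴` (TA3b `TorusTraceTadpole.tendsto_hessT_hessKer`).  THIS FILE is the exact matrix-level dictionary entry in between: for ANY background family whose
bordered matrix has `C²` entries and is nonsingular at `0`, the (1.20)-polarization IS `−hessT` of the bordered inverse against the first and second jets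
of the bordered matrix, and the first jet of `log Z` IS `−½` of the corresponding tadpole trace.  With it, W-4 for a periodised literal family reduces to:
(i) its bordered inverse's packed blocks are the co-dressed resolvent (TB1, `RelInvCombBorderedKKT`), (ii) its jets `F.dK`, `F.d2K` are the (periodised
arrays of the) literal's tables — a statement about how the family is BUILT, not an estimate.

WHAT (all [folklore]; `F : Family ι n m`):
**`polarization_eq_neg_hessT`** (`C²` entries, `det K₀ ≠ 0` ⟹ `polarization F i j = −hessT ((F 0).kkt⁻¹) (F.dK i) (F.dK j) (F.d2K i j)`),
**`polarization_eq_neg_hessT_of_mul_eq_one`** (socket form: `X·K₀ = 1 ⟹ … = −hessT X …`).  (The first-jet twin `∂ᵢ(F.logZ)(0) = −½·tr(K₀⁻¹·F.dK i)` IS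
`LogZFirstJet.fderiv_logZ_single`, and the jet symmetry of `hessT` IS `MixedVarPackedHess.hessT_comm` — used BY NAME, not restated.)
Provenance: β sub-cell, unit beta-an2 gen 24 (prover-b2b-balaban-beta-an2-g24-0), 2026-08-21.  NOT (SDF), NOT D1, NOT `BetaPertH`, NOT continuum, NOT Clay.
-/

noncomputable section

open Matrix Topology Filter
open Literature.MathematicalPhysics.QuantumFieldTheory.Balaban1983to89.Beta (Family ConstrainedGaussian polarization)
open Summit.QuantumFields.BalabanUV.Beta.D1BFx.MixedVarPackedHess (hessT)

namespace Summit.QuantumFields.BalabanUV.Beta.PolarizationHessT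

variable {ι : Type*} [Fintype ι] [DecidableEq ι] {n m : ℕ}

/-- [folklore] **THE POLARIZATION IS `−hessT` OF THE BORDERED INVERSE AGAINST THE JETS**: for a background family with `C²` entries and nonsingular bordered
matrix `K₀`, `polarization F i j = −hessT (K₀⁻¹) (∂ᵢK) (∂ⱼK) (∂ᵢ∂ⱼK)` (`∂ᵢK = F.dK i`, `∂ᵢ∂ⱼK = F.d2K i j` of `LogDetHessian`). -/
theorem polarization_eq_neg_hessT (F : Family ι n m)
    (hQ : ∀ a b, ContDiffAt ℝ 2 (fun B => (F B).Q a b) 0) (hΔ : ∀ a b, ContDiffAt ℝ 2 (fun B => (F B).Δ a b) 0)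
    (hdet : (F 0).kkt.det ≠ 0) (i j : ι) :
    polarization F i j = -hessT ((F 0).kkt⁻¹) (F.dK i) (F.dK j) (F.d2K i j) := by
  rw [Family.polarization_eq_trace F hQ hΔ hdet i j, hessT]
  have e : (F 0).kkt⁻¹ * F.dK i * (F 0).kkt⁻¹ * F.dK j = (F 0).kkt⁻¹ * F.dK i * ((F 0).kkt⁻¹ * F.dK j) := by
    simp only [Matrix.mul_assoc]
  rw [e]
  ring

/-- [folklore] **SOCKET FORM**: if `X·K₀ = 1` (a two-sided inverse on the finite index type) then `polarization F i j = −hessT X (∂ᵢK) (∂ⱼK) (∂ᵢ∂ⱼK)` — the shape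
road BF-x's TB-bricks fill with the periodised dressed pack. -/
theorem polarization_eq_neg_hessT_of_mul_eq_one (F : Family ι n m)
    (hQ : ∀ a b, ContDiffAt ℝ 2 (fun B => (F B).Q a b) 0) (hΔ : ∀ a b, ContDiffAt ℝ 2 (fun B => (F B).Δ a b) 0)
    {X : Matrix (Fin n ⊕ Fin m) (Fin n ⊕ Fin m) ℝ} (hX : X * (F 0).kkt = 1) (i j : ι) :
    polarization F i j = -hessT X (F.dK i) (F.dK j) (F.d2K i j) := by
  have hdet : (F 0).kkt.det ≠ 0 := by
    have h := congrArg Matrix.det hX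
    rw [Matrix.det_mul, Matrix.det_one] at h
    intro h0; rw [h0, mul_zero] at h; exact zero_ne_one h
  have hinv : (F 0).kkt⁻¹ = X := Matrix.inv_eq_left_inv hX
  rw [polarization_eq_neg_hessT F hQ hΔ hdet, hinv]

end Summit.QuantumFields.BalabanUV.Beta.PolarizationHessT

end
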